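import Summits.CriticalPhenomena.PercolationContinuityZ3.Theorems.SahiMasterFamilyFInequalityTwistedMaricaSchonheim
import Mathlib.LinearAlgebra.Matrix.Rank

/-!
# The linear-algebra form (LA) of the abstract twisted Marica–Schönheim conjecture, and (LA) ⟹ (AMS) ⟹ F_comb on G ⊆ A ∪ B

Support file for the master-family `F`-inequality programme (`prim-master-conj` gen 26; `--supports stmt-CriticalPhenomena-4575`;
memo `run/shared/lean/prim/prim-l12/prim-master-conj/POINTWISE.md` §27).  Two definitions (a named finset and a conjecture stated as a
`Prop`), no `sorry`, standard axioms.

Setting (`TwistedAD.AMSWeighted`): `S` a complement-closed family of points of the cube, `R` an equivalence relation with `¬R x xᶜ` on `S`,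
`J(S,R) = {x ∪ z : x, z ∈ S, ¬R x z, ¬R xᶜ zᶜ}` the admissible unions (`amsUnions S R` below); the counting form of (AMS) is `#S ≤ 2·#J(S,R)`.

NEW (gen 26, POINTWISE §27 (V3)–(V5)): consider the `S × J(S,R)` matrix `L[w,u] = 𝟙[wᶜ ⊆ u]` over `ℚ` (equivalently `𝟙[uᶜ ⊆ w]`: the
containment matrix between the points of `S` and the admissible *differences* `D = J(S,R)ᶜˢ`).  Trivially `rank L ≤ #J(S,R)`, so the

* **CONJECTURE (LA)** (`LARank`): `#S ≤ 2 · rank_ℚ L`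

implies (AMS) in counting form — and (LA) is what the data support: it holds (with equality attained) for every complement-closed `S ⊆ 2^[k]`,
`k ≤ 4`, with every labelling by ≤ 4 labels (exhaustive over all families with ≤ 6 antipodal pairs, 1.9·10⁶ instances), and for 5·10⁵ random
instances in dimensions 5–7 with up to 6 labels (seat census `code-g26/rankc.c`; kit job j170509 re-runs it at scale; 0 failures).  For two labels (one class `A`, `S = A ⊔ Aᶜˢ`) the stronger statement `rank 𝟙[d ⊆ a]_{a ∈ A, d ∈ A \\ A}
= #A` holds and has a ten-line proof (§27 (V4): the matrix `[f(a \ a')]_{a,a'∈A}` with independent indeterminates `f_d`, `d ∈ A \\ A`, has the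
monomial `f_∅^{#A}` exactly once in its determinant and factors as `Σ_{e ∈ A\\A} h(e)·𝟙[e ⊆ a]𝟙[e ∩ a' = ∅]`), which is a new proof of the
Marica–Schönheim inequality; (LA) is the conjectural extension of that rank statement to several classes.

Contents:
* `amsUnions S R` — the finset `J(S,R)` (definitionally the expression used in `AMSWeighted`);
* `laMatrix S R` — the matrix `L`;  `LARank` — conjecture (LA);
* `card_le_two_mul_card_amsUnions_of_LARank` — (LA) ⟹ `#S ≤ 2·#J(S,R)` (`Matrix.rank_le_card_width`);
* `amsWeighted_one_of_LARank` — (LA) ⟹ `AMSWeighted 1`;  hence, by the chain already in the tree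
  (`KCWeighted_of_AMSWeighted`, `weightedFcomb_nonneg_of_KC_of_subset_union`):
* `kcWeighted_one_of_LARank` and `fcomb_nonneg_of_LARank_of_subset_union` — (LA) ⟹ (KC) with unit weight ⟹ `F_comb(A,B,G) ≥ 0`
  for all upper `A, B, G` with `G ⊆ A ∪ B`, in every dimension.

HONEST FRAMING: (LA) is OPEN (a conjecture of this programme, not a published result); everything here is a reduction. [this work]
-/

namespace Summit.CriticalPhenomena.PercolationContinuityZ3.Theorems

namespace TwistedAD

open Finset
open scoped FinsetFamily Classical

variable {κ : Type*} [Fintype κ] [DecidableEq κ]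

/-- The admissible unions `J(S,R) = {x ∪ z : x, z ∈ S, ¬R x z, ¬R xᶜ zᶜ}` of a family `S` and a relation `R` (the finset appearing in
`AMSWeighted`). [this work] -/
noncomputable def amsUnions (S : Finset (Finset κ)) (R : Finset κ → Finset κ → Prop) : Finset (Finset κ) :=
  ((S ×ˢ S).filter (fun p => ¬ R p.1 p.2 ∧ ¬ R p.1ᶜ p.2ᶜ)).image (fun p => p.1 ∪ p.2)

/-- The co-containment matrix of `(S, R)`: rows the points `w ∈ S`, columns the admissible unions `u ∈ J(S,R)`, entry `1` if `wᶜ ⊆ u`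
(i.e. the admissible difference `uᶜ` lies inside `w`), else `0`; over `ℚ`. [this work] -/
noncomputable def laMatrix (S : Finset (Finset κ)) (R : Finset κ → Finset κ → Prop) : Matrix ↥S ↥(amsUnions S R) ℚ :=
  Matrix.of fun w u => if (w : Finset κ)ᶜ ⊆ (u : Finset κ) then 1 else 0

/-- **CONJECTURE (LA) — linear-algebra form of the abstract twisted Marica–Schönheim conjecture** (POINTWISE §27; STATUS: open;
verified for all complement-closed `S ⊆ 2^[k]` with ≤ 6 antipodal pairs, `k ≤ 4`, all labellings with ≤ 4 labels, and on 5·10⁵ random instances in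
dimensions 5–7 with ≤ 6 labels, 0 failures, equality attained).  For every complement-closed `S` and every equivalence relation `R` with
`¬R x xᶜ` on `S`: `#S ≤ 2 · rank_ℚ (laMatrix S R)`. [this work] -/
def LARank : Prop :=
  ∀ (S : Finset (Finset κ)) (R : Finset κ → Finset κ → Prop), Equivalence R → (∀ x ∈ S, xᶜ ∈ S) → (∀ x ∈ S, ¬ R x xᶜ) →
    S.card ≤ 2 * (laMatrix S R).rank

/-- **(LA) ⟹ (AMS), counting form**: the rank of `laMatrix S R` is at most its number of columns `#J(S,R)`. [this work] -/
theorem card_le_two_mul_card_amsUnions_of_LARank (h : LARank (κ := κ)) (S : Finset (Finset κ))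
    (R : Finset κ → Finset κ → Prop) (hR : Equivalence R) (hScl : ∀ x ∈ S, xᶜ ∈ S) (hanti : ∀ x ∈ S, ¬ R x xᶜ) :
    S.card ≤ 2 * (amsUnions S R).card := by
  have h1 := h S R hR hScl hanti
  have h2 : (laMatrix S R).rank ≤ Fintype.card ↥(amsUnions S R) := Matrix.rank_le_card_width _
  rw [Fintype.card_coe] at h2
  exact h1.trans (Nat.mul_le_mul_left 2 h2)

/-- **(LA) ⟹ `AMSWeighted 1`** (the abstract twisted Marica–Schönheim inequality with unit weight). [this work] -/
theorem amsWeighted_one_of_LARank (h : LARank (κ := κ)) : AMSWeighted (fun _ : Finset κ => (1 : ℝ)) := by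
  intro S R hR hScl hanti
  have key := card_le_two_mul_card_amsUnions_of_LARank h S R hR hScl hanti
  have e1 : ∑ x ∈ S, (fun _ : Finset κ => (1 : ℝ)) x = (S.card : ℝ) := by
    rw [sum_const, nsmul_eq_mul, mul_one]
  have e2 : ∑ u ∈ ((S ×ˢ S).filter (fun p => ¬ R p.1 p.2 ∧ ¬ R p.1ᶜ p.2ᶜ)).image (fun p => p.1 ∪ p.2),
      (fun _ : Finset κ => (1 : ℝ)) u = ((amsUnions S R).card : ℝ) := by
    rw [sum_const, nsmul_eq_mul, mul_one]
    rfl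
  rw [e1, e2]
  exact_mod_cast key

/-- **(LA) ⟹ (KC) with unit weight** (the strengthened Kleitman inequality `cc(Y∖V) ≤ 2·#{v ∈ V : vᶜ ∉ Y}`, via `KCWeighted_of_AMSWeighted`).
[this work] -/
theorem kcWeighted_one_of_LARank (h : LARank (κ := κ)) : KCWeighted (fun _ : Finset κ => (1 : ℝ)) :=
  KCWeighted_of_AMSWeighted _ (fun _ => zero_le_one) (amsWeighted_one_of_LARank h)

/-- **(LA) ⟹ `F_comb ≥ 0` on the class `G ⊆ A ∪ B`**, every dimension: for upper families `A, B, G` of the cube with `G ⊆ A ∪ B`,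
`0 ≤ Σ_s [𝟙_{A∩B∩G}(s) − 𝟙_{A∩G}(s)𝟙_{B∩G}(sᶜ) − 𝟙_G(s)𝟙_{(A∩B)∖G}(sᶜ)]` (all Bernstein coefficients of `F` on this class).  Chain:
`LARank → AMSWeighted 1 → KCWeighted 1 → weightedFcomb_nonneg_of_KC_of_subset_union`.  CONDITIONAL on (LA). [this work] -/
theorem fcomb_nonneg_of_LARank_of_subset_union (h : LARank (κ := κ))
    (A B G : Finset (Finset κ)) (hA : IsUpperSet (A : Set (Finset κ))) (hB : IsUpperSet (B : Set (Finset κ)))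
    (hG : IsUpperSet (G : Set (Finset κ))) (hGAB : G ⊆ A ∪ B) :
    0 ≤ ∑ s, (fun _ : Finset κ => (1 : ℝ)) s *
        ((if s ∈ A ∩ B ∩ G then (1 : ℝ) else 0) - (if s ∈ A ∩ G then (1 : ℝ) else 0) * (if sᶜ ∈ B ∩ G then 1 else 0)
          - (if s ∈ G then (1 : ℝ) else 0) * (if sᶜ ∈ (A ∩ B) \ G then 1 else 0)) :=
  weightedFcomb_nonneg_of_KC_of_subset_union _ (fun _ => zero_le_one) (fun _ => rfl) (kcWeighted_one_of_LARank h)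
    A B G hA hB hG hGAB

end TwistedAD

end Summit.CriticalPhenomena.PercolationContinuityZ3.Theorems
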